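import Literature.NumberTheory.EllipticCurves.Kato2004.HullDescentEqualityProofs
import HarnessLib

/-!
# Kato's §14.14 descent through the reflexive hull — the zeta element SURVIVES at the bottom layer
# under Conj. 12.10 (module theory over `Λ = ℤ_p⟦T⟧`; companion of `HullDescentEqualityProofs`)

`HullDescentEqualityProofs` (cell `bsd-potss`, seat `kmc`, part 14a) proves the descent of Conj. 12.10
through the hull, `ℓ_𝔮(H2) = ℓ_𝔮(F/Λz)` at every height-one `𝔮` ⇒ `[A : Λ·ι(ȳ)] = p^e · #(H2/TH2)`,
under the extra hypothesis `[A : Λ·ι(ȳ)] ≠ 0` ("the zeta element survives at the bottom layer":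
`ȳ` is non-torsion in `A = H¹(ℤ[1/p],T)`). In analytic rank `0` that hypothesis is Kato's Thm. 14.5
(2) (`exp* loc_p z = L(E,1)/Ω ≠ 0`); in analytic rank ONE it is Perrin-Riou's non-vanishing
conjecture (the bottom layer `z_ℚ` of the zeta element is non-torsion in `H¹(ℤ[1/p],T) ≅ ℤ_p ⊕
(finite)`). This file shows that it is AUTOMATIC under Conj. 12.10 whenever `H2/TH2` is finite:

* `lengthAt_primeT_quotient_span_smul_eq_zero` — `ℓ_{(T)}(F/Λz) = 0 ⇒ ℓ_{(T)}(F/Λ(c·z)) = 0` for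
  `c ∉ (T)` (the extra piece `Λz/Λcz` is killed by `c`);
* `index_ne_zero_of_hull_of_lengthAt_primeT_eq_zero` — **`ℓ_{(T)}(F/Λz) = 0` and `H2/TH2` finite ⇒
  `[A : Λ·ι(ȳ)] ≠ 0`**: `H/Λy ↪ F/Λ(p^e z)` gives `ℓ_{(T)}(H/Λy) = 0`, so `(H/Λy)/T` is finite
  (the `Γ`-Euler characteristic, `card_coinvariants_of_lengthAt_eq_zero`), and
  `[A : Λ·ι(ȳ)] = #H2[T] · #((H/Λy)/T)` along (14.14.1);
* `index_ne_zero_of_hull_of_lengthAt_eq` — under Conj. 12.10 read on the hull (`ℓ_𝔮(H2) =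
  ℓ_𝔮(F/Λz)` at every height-one `𝔮`) and `H2/TH2` finite, `ℓ_{(T)}(F/Λz) = ℓ_{(T)}(H2) = 0`, hence
  `[A : Λ·ι(ȳ)] ≠ 0` — in analytic rank one: **Kato's Main Conjecture implies Perrin-Riou's
  non-vanishing** at a lattice whose zeta element is only in the hull;
* `index_eq_pow_mul_natCard_coinvariants_of_hull_of_lengthAt_eq'` — the descent of Conj. 12.10
  through the hull with the survival hypothesis REMOVED.

Module theory only: nothing about Kato's objects `𝐇^q(T)`, `z_γ`, `H^q(ℤ[1/p],T)` is asserted; the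
dictionary is in the docstrings (`F = 𝐇¹(T)^{**}`, `H = 𝐇¹(T)`, `H2 = 𝐇²(T)`, `A = H¹(ℤ[1/p],T)`,
(14.14.1) `0 → H/TH →ι A →π H2[T] → 0`). Consumer: `Summits/BirchSwinnertonDyer/Rank1Residual/O6/
PotGoodRankOneOfHullKMC.lean` (the exact rank-ONE count at an arbitrary member of the isogeny class).

References: [Kato2004Asterisque] Thm. 12.4 (p. 221), Thm. 12.6 (p. 222), Conj. 12.10 (p. 224), 13.14
(p. 234), Thm. 14.5 and the index `[M : z]` (pp. 236–237), §14.14 (14.14.1)–(14.14.2) and Lemma 14.15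
(pp. 243–244); [Wuthrich2014] §3.2–3.4 (pp. 394–396); [BurnsKuriharaSano2019] Conj. 2.8 (i) (p. 10);
[PerrinRiou1993AIF] §3.3; the `Γ`-Euler characteristic: [GreenbergLNM1716] §4 Lemma 4.2,
[Washington1997] §13.2.
-/

noncomputable section

open scoped Classical

universe u

namespace Literature.NumberTheory.EllipticCurves.Kato2004

open Literature.NumberTheory.EllipticCurves.IwasawaAlgebra

variable {p : ℕ} [Fact p.Prime]

/-! ### §1 `ℓ_{(T)}` along a change of generator `z ↦ c·z`, `c ∉ (T)` -/

section Generator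

variable {F : Type u} [AddCommGroup F] [Module (IwasawaAlgebra p) F]

/-- **`ℓ_{(T)}(F/Λz) = 0 ⇒ ℓ_{(T)}(F/Λ(c·z)) = 0` for `c ∉ (T)`**: along
`Λz̄ ↪ F/Λ(c·z) ↠ F/Λz` the kernel `Λz̄` (the image of `Λz`) is killed by `c`, so its localisation
at `(T)` vanishes, and the local length is subadditive. (Used with `c = p^e`: Kato's `z = c⁻¹y`,
p. 236.) [cite: Kato2004Asterisque, definition of `[M : z]` (pp. 236–237), Lemma 14.15 (p. 244)] -/
theorem lengthAt_primeT_quotient_span_smul_eq_zero {c : IwasawaAlgebra p}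
    (hcT : c ∉ (primeT p).asIdeal) (z : F)
    (hT : Module.lengthAt (IwasawaAlgebra p) (F ⧸ (IwasawaAlgebra p) ∙ z) (primeT p) = 0) :
    Module.lengthAt (IwasawaAlgebra p) (F ⧸ (IwasawaAlgebra p) ∙ (c • z)) (primeT p) = 0 := by
  set Zc : Submodule (IwasawaAlgebra p) F := (IwasawaAlgebra p) ∙ (c • z) with hZc
  set Z : Submodule (IwasawaAlgebra p) F := (IwasawaAlgebra p) ∙ z with hZ
  have hle : Zc ≤ Z := by
    rw [hZc, Submodule.span_singleton_le_iff_mem]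
    exact Submodule.smul_mem _ c (Submodule.mem_span_singleton_self z)
  -- the image `M' = Λ·z̄` of `Λz` in `F/Λcz` is the kernel of `ψ : F/Λcz → F/Λz`
  set M' : Submodule (IwasawaAlgebra p) (F ⧸ Zc) := Z.map Zc.mkQ with hM'
  set ψ : (F ⧸ Zc) →ₗ[IwasawaAlgebra p] F ⧸ Z := Submodule.factor hle with hψ
  have hkerψ : LinearMap.ker ψ = M' := by
    ext q
    induction q using Submodule.Quotient.induction_on with
    | H x =>
      rw [LinearMap.mem_ker]
      change Submodule.Quotient.mk (p := Z) x = 0 ↔ _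
      rw [Submodule.Quotient.mk_eq_zero, hM']
      constructor
      · intro hx
        exact ⟨x, hx, rfl⟩
      · rintro ⟨x', hx', hxx'⟩
        rw [Submodule.mkQ_apply, Submodule.Quotient.eq] at hxx'
        have : x = x' - (x' - x) := by abel
        rw [this]
        exact Z.sub_mem hx' (hle hxx')
  have hex : Function.Exact M'.subtype ψ := by
    rw [LinearMap.exact_iff, hkerψ, Submodule.range_subtype]
  -- `M'` is killed by `c`: `c • (a•z mod Λcz) = a • (c•z) mod Λcz = 0`
  have hcM' : Module.IsTorsionBy (IwasawaAlgebra p) M' c := by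
    rintro ⟨m, hm⟩
    rw [hM', Submodule.mem_map] at hm
    obtain ⟨w, hw, rfl⟩ := hm
    rw [hZ, Submodule.mem_span_singleton] at hw
    obtain ⟨a, rfl⟩ := hw
    apply Subtype.ext
    change c • (Zc.mkQ (a • z)) = 0
    rw [← map_smul, Submodule.mkQ_apply, Submodule.Quotient.mk_eq_zero, smul_smul, mul_comm,
      ← smul_smul, hZc]
    exact Submodule.smul_mem _ a (Submodule.mem_span_singleton_self _)
  have hM'0 : Module.lengthAt (IwasawaAlgebra p) M' (primeT p) = 0 :=
    Module.lengthAt_eq_zero_of_isTorsionBy hcM' (primeT p) hcT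
  have hle' := Module.lengthAt_le_add_of_exact M'.subtype ψ hex (primeT p)
  rw [hM'0, hT, zero_add] at hle'
  exact le_antisymm hle' bot_le

end Generator

/-! ### §2 The zeta element survives at the bottom layer -/

section Hull

variable {F H H2 A : Type u} [AddCommGroup F] [Module (IwasawaAlgebra p) F]
  [AddCommGroup H] [Module (IwasawaAlgebra p) H] [AddCommGroup H2] [Module (IwasawaAlgebra p) H2]
  [AddCommGroup A] [Module (IwasawaAlgebra p) A]
  [Module.Finite (IwasawaAlgebra p) F] [NoZeroSMulDivisors (IwasawaAlgebra p) F]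
  [Module.Finite (IwasawaAlgebra p) H] [NoZeroSMulDivisors (IwasawaAlgebra p) H]
  [Module.Finite (IwasawaAlgebra p) H2]

omit [Module.Finite (IwasawaAlgebra p) F] [NoZeroSMulDivisors (IwasawaAlgebra p) F] in
/-- `F/Λ(c·z)` is torsion when `F/Λz` is and `c ≠ 0` (private helper, as in parts 11/14a). [folklore] -/
private theorem isTorsion_quotient_span_smul_of_ne_zero' {c : IwasawaAlgebra p} (hc : c ≠ 0) (z : F)
    (hFZ : Module.IsTorsion (IwasawaAlgebra p) (F ⧸ (IwasawaAlgebra p) ∙ z)) :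
    Module.IsTorsion (IwasawaAlgebra p) (F ⧸ (IwasawaAlgebra p) ∙ (c • z)) := by
  intro q
  induction q using Submodule.Quotient.induction_on with
  | H x =>
    obtain ⟨a, ha⟩ := @hFZ (Submodule.Quotient.mk x)
    rw [Submonoid.smul_def, ← Submodule.Quotient.mk_smul, Submodule.Quotient.mk_eq_zero,
      Submodule.mem_span_singleton] at ha
    obtain ⟨b, hb⟩ := ha
    refine ⟨⟨c * (a : IwasawaAlgebra p),
      mul_mem (mem_nonZeroDivisors_of_ne_zero hc) a.2⟩, ?_⟩
    rw [Submonoid.smul_def]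
    change (c * (a : IwasawaAlgebra p)) • Submodule.Quotient.mk x = 0
    rw [← Submodule.Quotient.mk_smul, Submodule.Quotient.mk_eq_zero, Submodule.mem_span_singleton]
    exact ⟨b, by rw [mul_smul, ← hb, smul_comm]⟩

omit [NoZeroSMulDivisors (IwasawaAlgebra p) F] [NoZeroSMulDivisors (IwasawaAlgebra p) H] in
/-- **THE ZETA ELEMENT SURVIVES AT THE BOTTOM LAYER: `ℓ_{(T)}(F/Λz) = 0` and `H2/TH2` finite ⇒
`[A : Λ·ι(ȳ)] ≠ 0`.** Over `Λ = ℤ_p⟦T⟧`: `F` finitely generated torsion free (`𝐇¹(T)^{**}`),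
`j : H ↪ F` of finite index (`H = 𝐇¹(T)`, Thm. 12.4 (2)), `z ∈ F` with `F/Λz` torsion (the zeta
element, rank one; Thm. 12.6 + 13.14), `H2` finitely generated torsion (`𝐇²(T)`, Thm. 12.4 (1)),
`0 → H/TH →ι A →π H2[T] → 0` exact ((14.14.1), `A = H¹(ℤ[1/p],T)`), `H2/TH2` finite ((14.14.2)),
`y ∈ H` with `j(y) = p^e·z`. If `T ∤ char(F/Λz)` (`ℓ_{(T)}(F/Λz) = 0`), then `ȳ` is non-torsion in
`A`: `ℓ_{(T)}(F/Λ p^e z) = 0` (§1), `H/Λy ↪ F/Λ j(y)` so `ℓ_{(T)}(H/Λy) = 0`, hence `(H/Λy)/T` is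
finite (the `Γ`-Euler characteristic), and `[A : Λ·ι(ȳ)] = #H2[T] · #((H/Λy)/T)` with both factors
finite and non-zero. Module theory only; nothing about Kato's objects is asserted.
[cite: Kato2004Asterisque, §14.14 (14.14.1)–(14.14.2) and Lemma 14.15 (pp. 243–244), Thm. 14.5 (1)–(2) (p. 236), `[M : z]` (pp. 236–237)]
[cite: GreenbergLNM1716, §4 Lemma 4.2] -/
theorem index_ne_zero_of_hull_of_lengthAt_primeT_eq_zero (j : H →ₗ[IwasawaAlgebra p] F)
    (hj : Function.Injective j) (hcok : Finite (F ⧸ LinearMap.range j)) (z : F)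
    (hFZ : Module.IsTorsion (IwasawaAlgebra p) (F ⧸ (IwasawaAlgebra p) ∙ z))
    (hH2 : Module.IsTorsion (IwasawaAlgebra p) H2)
    (hT : Module.lengthAt (IwasawaAlgebra p) (F ⧸ (IwasawaAlgebra p) ∙ z) (primeT p) = 0)
    (y : H) (e : ℕ) (hy : j y = PowerSeries.C ((p : ℤ_[p]) ^ e) • z)
    (ι : coinvariants p H →ₗ[IwasawaAlgebra p] A) (π : A →ₗ[IwasawaAlgebra p] invariants p H2)
    (hι : Function.Injective ι) (hπ : Function.Surjective π) (hex : Function.Exact ι π)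
    (hfin : Finite (coinvariants p H2)) :
    Nat.card (A ⧸ (IwasawaAlgebra p) ∙ ι (Submodule.Quotient.mk y)) ≠ 0 := by
  have hp0 : (p : ℤ_[p]) ≠ 0 := by exact_mod_cast (Fact.out : p.Prime).ne_zero
  have hc : PowerSeries.C ((p : ℤ_[p]) ^ e) ≠ (0 : IwasawaAlgebra p) := by
    rw [Ne, ← map_zero (PowerSeries.C (R := ℤ_[p])), PowerSeries.C_injective.eq_iff]
    exact pow_ne_zero _ hp0
  have hcT : PowerSeries.C ((p : ℤ_[p]) ^ e) ∉ (primeT p).asIdeal := by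
    rw [primeT_asIdeal, mem_span_X_iff, PowerSeries.constantCoeff_C]
    exact pow_ne_zero _ hp0
  -- `ℓ_{(T)}(F/Λ j y) = 0`
  have hTjy : Module.lengthAt (IwasawaAlgebra p) (F ⧸ (IwasawaAlgebra p) ∙ j y) (primeT p) = 0 := by
    rw [hy]; exact lengthAt_primeT_quotient_span_smul_eq_zero hcT z hT
  have hFy : Module.IsTorsion (IwasawaAlgebra p) (F ⧸ (IwasawaAlgebra p) ∙ j y) := by
    rw [hy]; exact isTorsion_quotient_span_smul_of_ne_zero' hc z hFZ
  -- the injection `θ : H/Λy ↪ F/Λ j(y)`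
  set Y : Submodule (IwasawaAlgebra p) H := (IwasawaAlgebra p) ∙ y with hY
  set W : Submodule (IwasawaAlgebra p) F := (IwasawaAlgebra p) ∙ j y with hW
  have hmap : Y.map j = W := by rw [hY, hW, Submodule.map_span, Set.image_singleton]
  have hcomap : Y ≤ W.comap j := by rw [← hmap]; exact Submodule.le_comap_map _ _
  set θ : (H ⧸ Y) →ₗ[IwasawaAlgebra p] F ⧸ W := Submodule.mapQ Y W j hcomap with hθ
  have hθ_inj : Function.Injective θ := by
    rw [← LinearMap.ker_eq_bot, hθ, Submodule.mapQ, Submodule.ker_liftQ, LinearMap.ker_comp,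
      Submodule.ker_mkQ, ← hmap, Submodule.comap_map_eq, LinearMap.ker_eq_bot.mpr hj, sup_bot_eq,
      Submodule.mkQ_map_self]
  -- `ℓ_{(T)}(H/Λy) = 0`, hence `(H/Λy)/T` is finite
  have hTQ : Module.lengthAt (IwasawaAlgebra p) (H ⧸ Y) (primeT p) = 0 := by
    have h1 := Module.lengthAt_le_of_injective θ hθ_inj (primeT p)
    rw [hTjy] at h1
    exact le_antisymm h1 bot_le
  obtain ⟨hHy, -⟩ := eulerExp_quotient_span_eq_of_finite_index j hj hcok y hFy
  obtain ⟨-, hfinQ, -⟩ := card_coinvariants_of_lengthAt_eq_zero (H ⧸ Y) hHy hTQ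
  obtain ⟨hfinT, -⟩ := natCard_coinvariants_eq_of_finite H2 hH2 hfin
  haveI := hfinQ
  haveI := hfinT
  -- `[A : Λ·ι ȳ] = #H2[T] · #((H/Λy)/T)`
  have hA : Nat.card (A ⧸ (IwasawaAlgebra p) ∙ ι (Submodule.Quotient.mk y)) =
      Nat.card (invariants p H2) * Nat.card (coinvariants p (H ⧸ Y)) := by
    rw [natCard_quotient_eq_of_exact ι π hι hπ hex, ← natCard_coinvariants_quotient_span y]
  have h1 : 0 < Nat.card (invariants p H2) := Nat.card_pos
  have h2 : 0 < Nat.card (coinvariants p (H ⧸ Y)) := Nat.card_pos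
  rw [hA]
  exact (Nat.mul_pos h1 h2).ne'

omit [NoZeroSMulDivisors (IwasawaAlgebra p) F] [NoZeroSMulDivisors (IwasawaAlgebra p) H] in
/-- **Conj. 12.10 read on the hull and `H2/TH2` finite ⇒ the zeta element survives at the bottom
layer** (`[A : Λ·ι(ȳ)] ≠ 0`): `ℓ_{(T)}(F/Λz) = ℓ_{(T)}(H2) = 0` (`H2/TH2` finite). In analytic rank
one this reads: Kato's Main Conjecture implies Perrin-Riou's non-vanishing of the bottom layer `z_ℚ`
of the zeta element (Burns–Kurihara–Sano Conj. 2.8 (i)), at ANY lattice — the hypothesis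
`[A : Λ·ι(ȳ)] ≠ 0` of `index_eq_pow_mul_natCard_coinvariants_of_hull_of_lengthAt_eq` is automatic.
Module theory only. [cite: Kato2004Asterisque, Conj. 12.10 (p. 224), §14.14 and Lemma 14.15 (pp. 243–244)]
[cite: BurnsKuriharaSano2019, Conj. 2.8 (i) (p. 10)] -/
theorem index_ne_zero_of_hull_of_lengthAt_eq (j : H →ₗ[IwasawaAlgebra p] F)
    (hj : Function.Injective j) (hcok : Finite (F ⧸ LinearMap.range j)) (z : F)
    (hFZ : Module.IsTorsion (IwasawaAlgebra p) (F ⧸ (IwasawaAlgebra p) ∙ z))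
    (hH2 : Module.IsTorsion (IwasawaAlgebra p) H2)
    (hMC : ∀ 𝔮 : PrimeSpectrum (IwasawaAlgebra p), 𝔮.asIdeal.height = 1 →
      Module.lengthAt (IwasawaAlgebra p) H2 𝔮 =
        Module.lengthAt (IwasawaAlgebra p) (F ⧸ (IwasawaAlgebra p) ∙ z) 𝔮)
    (y : H) (e : ℕ) (hy : j y = PowerSeries.C ((p : ℤ_[p]) ^ e) • z)
    (ι : coinvariants p H →ₗ[IwasawaAlgebra p] A) (π : A →ₗ[IwasawaAlgebra p] invariants p H2)
    (hι : Function.Injective ι) (hπ : Function.Surjective π) (hex : Function.Exact ι π)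
    (hfin : Finite (coinvariants p H2)) :
    Nat.card (A ⧸ (IwasawaAlgebra p) ∙ ι (Submodule.Quotient.mk y)) ≠ 0 := by
  have hT : Module.lengthAt (IwasawaAlgebra p) (F ⧸ (IwasawaAlgebra p) ∙ z) (primeT p) = 0 := by
    rw [← hMC (primeT p) (height_primeT p)]
    exact lengthAt_primeT_eq_zero_of_finite_coinvariants H2 hH2 hfin
  exact index_ne_zero_of_hull_of_lengthAt_primeT_eq_zero j hj hcok z hFZ hH2 hT y e hy ι π hι hπ
    hex hfin

/-- **THE DESCENT OF CONJ. 12.10 THROUGH THE HULL, survival hypothesis removed**: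
`ℓ_𝔮(H2) = ℓ_𝔮(F/Λz)` at every height-one `𝔮` and `H2/TH2` finite ⇒
`[A : Λ·ι(ȳ)] = p^e · #(H2/TH2)` (i.e. `[H¹(ℤ[1/p],T) : z] = #H²(ℤ[1/p],T)`, Kato's `μ = 1`) —
`index_eq_pow_mul_natCard_coinvariants_of_hull_of_lengthAt_eq` with its hypothesis `[A : Λ·ι(ȳ)] ≠ 0`
discharged by `index_ne_zero_of_hull_of_lengthAt_eq`. Module theory only.
[cite: Kato2004Asterisque, Conj. 12.10 (p. 224), §14.14 and Lemma 14.15 (pp. 243–244), p. 237] [cite: Wuthrich2014, §3.2 (p. 394)] -/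
theorem index_eq_pow_mul_natCard_coinvariants_of_hull_of_lengthAt_eq' (j : H →ₗ[IwasawaAlgebra p] F)
    (hj : Function.Injective j) (hcok : Finite (F ⧸ LinearMap.range j)) (z : F) (hz : z ≠ 0)
    (hFZ : Module.IsTorsion (IwasawaAlgebra p) (F ⧸ (IwasawaAlgebra p) ∙ z))
    (hH2 : Module.IsTorsion (IwasawaAlgebra p) H2)
    (hMC : ∀ 𝔮 : PrimeSpectrum (IwasawaAlgebra p), 𝔮.asIdeal.height = 1 →
      Module.lengthAt (IwasawaAlgebra p) H2 𝔮 =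
        Module.lengthAt (IwasawaAlgebra p) (F ⧸ (IwasawaAlgebra p) ∙ z) 𝔮)
    (y : H) (e : ℕ) (hy : j y = PowerSeries.C ((p : ℤ_[p]) ^ e) • z)
    (ι : coinvariants p H →ₗ[IwasawaAlgebra p] A) (π : A →ₗ[IwasawaAlgebra p] invariants p H2)
    (hι : Function.Injective ι) (hπ : Function.Surjective π) (hex : Function.Exact ι π)
    (hfin : Finite (coinvariants p H2)) :
    Nat.card (A ⧸ (IwasawaAlgebra p) ∙ ι (Submodule.Quotient.mk y)) =
      p ^ e * Nat.card (coinvariants p H2) :=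
  index_eq_pow_mul_natCard_coinvariants_of_hull_of_lengthAt_eq j hj hcok z hz hFZ hH2 hMC y e hy ι π
    hι hπ hex hfin
    (index_ne_zero_of_hull_of_lengthAt_eq j hj hcok z hFZ hH2 hMC y e hy ι π hι hπ hex hfin)

end Hull

end Literature.NumberTheory.EllipticCurves.Kato2004

end
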